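import Mathlib
import Summits.ValiantsHypothesis.ValiantsHypothesis.Theorems.DivisionGapPerMultiplesHardRichPieceArith

/-!
# `DivisionGap.PerMultiplesHard` (stmt-ValiantsHypothesis-5068), line `uncharged-face-walk`:
the RICH PIECE, part 2 — the abstract extremal lemma (lead c9, cycle 9)

`extremal_piece`: in any family of "admissible" sub-boards of a host that contains the full board, is `K`-rich there,
and is closed under row/column removal and splitting with the fibre inequalities of `stub_matchingCount`, the sub-board
maximising the richness potential `Φ(R,C) = (log M(R,C) − log(#C)!)/#C + log(#C)/(32K)` is linear (`n ≤ K^{32K}·#C`), has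
minimum degrees `#C/(4K)` and Hall surplus `#C/(2048K²) + 1` (part 1 supplies the two potential inequalities).  Part 3
(`stub_richPiece`) instantiates it with the intrinsic matching counts.  Elementary. [folklore]
-/

noncomputable section

-- `Summit.ValiantsHypothesis.ValiantsHypothesis.…` is the tree's mandated layout (Sub = Summit).
set_option linter.dupNamespace false

open Finset
open scoped BigOperators

namespace Summit.ValiantsHypothesis.ValiantsHypothesis.Theorems.DivisionGap.PerMultiplesHard.RichPiece

open RichPieceArith

/-! ### The abstract extremal lemma -/

/-- **The Φ-maximal admissible sub-board is rich, has linear minimum degrees and Hall surplus (abstract form).**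
`adm` is a family of "admissible" sub-boards `(R, C)` of the host `G` (equal sides, nonempty) with a matching count
`M R C ∈ [1, (#C)!]`, containing the full board, `K`-rich on the full board (`n! ≤ Kⁿ·M(univ,univ)`), and closed under the
two moves with the fibre inequalities of `stub_matchingCount`: removing a row (resp. column) together with a suitable
partner costs at most a factor "degree", and splitting along a row set `U` costs at most `C(#N(U), #U)`.  Then some admissible
`(R, C)` with `c := #C` has `n ≤ K^{32K}·c`, every row/column of degree `≥ c/(4K)` inside the sub-board, and surplus
`s := c/(2048K²) + 1 < c`: every nonempty `U ⊆ R` with `#U + s ≤ c` sees `≥ #U + s` columns of `C`.  PROOF: maximise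
`Φ(R,C) = (log M − log c!)/c + log(c)/(32K)` over `adm` (`Finset.exists_max_image`); comparing with the full board gives richness and
`n ≤ K^{32K} c`; a low-degree row/column would raise `Φ` (`phi_lt_of_removal`), a deficient `U` would too (`split_absurd`). [folklore] -/
theorem extremal_piece :
    ∀ {n : ℕ} (G : Finset (Fin n × Fin n)) (K : ℕ) (adm : Finset (Finset (Fin n) × Finset (Fin n)))
      (M : Finset (Fin n) → Finset (Fin n) → ℕ), 1 ≤ K → 2 * K ^ (32 * K) ≤ n →
      ((Finset.univ : Finset (Fin n)), (Finset.univ : Finset (Fin n))) ∈ adm →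
      (∀ p ∈ adm, p.1.card = p.2.card) → (∀ p ∈ adm, 1 ≤ p.2.card) →
      (∀ p ∈ adm, 1 ≤ M p.1 p.2) → (∀ p ∈ adm, M p.1 p.2 ≤ p.2.card.factorial) →
      n.factorial ≤ K ^ n * M Finset.univ Finset.univ →
      (∀ p ∈ adm, ∀ x ∈ p.1, 2 ≤ p.2.card → ∃ y ∈ p.2, (p.1.erase x, p.2.erase y) ∈ adm ∧
        M p.1 p.2 ≤ (p.2.filter fun j => (x, j) ∈ G).card * M (p.1.erase x) (p.2.erase y)) →
      (∀ p ∈ adm, ∀ y ∈ p.2, 2 ≤ p.2.card → ∃ x ∈ p.1, (p.1.erase x, p.2.erase y) ∈ adm ∧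
        M p.1 p.2 ≤ (p.1.filter fun i => (i, y) ∈ G).card * M (p.1.erase x) (p.2.erase y)) →
      (∀ p ∈ adm, ∀ U ⊆ p.1, U.Nonempty → U.card < p.1.card → ∃ S ⊆ p.2, S.card = U.card ∧
        (U, S) ∈ adm ∧ (p.1 \ U, p.2 \ S) ∈ adm ∧
        M p.1 p.2 ≤ (p.2.filter fun j => ∃ r ∈ U, (r, j) ∈ G).card.choose U.card * (M U S * M (p.1 \ U) (p.2 \ S))) →
      ∃ p ∈ adm, n ≤ K ^ (32 * K) * p.2.card ∧ 2 ≤ p.2.card ∧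
        (∀ x ∈ p.1, p.2.card ≤ 4 * K * (p.2.filter fun j => (x, j) ∈ G).card) ∧
        (∀ y ∈ p.2, p.2.card ≤ 4 * K * (p.1.filter fun i => (i, y) ∈ G).card) ∧
        (∀ U ⊆ p.1, U.Nonempty → U.card + (p.2.card / (2048 * K ^ 2) + 1) ≤ p.2.card →
          U.card + (p.2.card / (2048 * K ^ 2) + 1) ≤ (p.2.filter fun j => ∃ r ∈ U, (r, j) ∈ G).card) := by
  intro n G K adm M hK hn h0 hcard hpos hM1 hMfac hrichG hrow hcol hsplit
  classical
  -- the potential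
  set μ : ℝ := 1 / (32 * (K : ℝ)) with hμ
  let φ : Finset (Fin n) × Finset (Fin n) → ℝ := fun p =>
    (Real.log (M p.1 p.2) - Real.log (p.2.card.factorial : ℕ)) / p.2.card + μ * Real.log p.2.card
  obtain ⟨p, hp, hmax⟩ := Finset.exists_max_image adm φ ⟨_, h0⟩
  have hKR : (1 : ℝ) ≤ K := by exact_mod_cast hK
  have hμ0 : 0 < μ := by rw [hμ]; positivity
  have hKpow : 1 ≤ K ^ (32 * K) := Nat.one_le_pow _ _ hK
  have hn1 : 1 ≤ n := by omega
  set c := p.2.card with hc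
  set m := M p.1 p.2 with hm
  have hc1 : 1 ≤ c := hpos p hp
  have hm1 : 1 ≤ m := hM1 p hp
  have hcR : (0 : ℝ) < c := by exact_mod_cast hc1
  have hcn : c ≤ n := by
    rw [hc]; exact le_trans (Finset.card_le_univ _) (by simp)
  -- Step A: compare with the full board
  have hφp : φ p = (Real.log m - Real.log (c.factorial : ℕ)) / c + μ * Real.log c := rfl
  have hφ0 : -Real.log K + μ * Real.log n ≤ φ (Finset.univ, Finset.univ) := by
    show -Real.log K + μ * Real.log n ≤
      (Real.log (M Finset.univ Finset.univ) - Real.log ((Finset.univ : Finset (Fin n)).card.factorial : ℕ)) /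
        (Finset.univ : Finset (Fin n)).card + μ * Real.log ((Finset.univ : Finset (Fin n)).card : ℕ)
    rw [Finset.card_univ, Fintype.card_fin]
    have hM0 : 1 ≤ M Finset.univ Finset.univ := hM1 _ h0
    have h1 : ((n.factorial : ℕ) : ℝ) ≤ (K : ℝ) ^ n * (M Finset.univ Finset.univ : ℕ) := by exact_mod_cast hrichG
    have h2 : Real.log (n.factorial : ℕ) ≤ n * Real.log K + Real.log (M Finset.univ Finset.univ : ℕ) := by
      have := Real.log_le_log (by exact_mod_cast Nat.factorial_pos n) h1
      rwa [Real.log_mul (by positivity) (by exact_mod_cast (show (M Finset.univ Finset.univ) ≠ 0 by omega)),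
        Real.log_pow] at this
    have hnR : (0 : ℝ) < n := by exact_mod_cast hn1
    have h3 : -Real.log K ≤ (Real.log (M Finset.univ Finset.univ : ℕ) - Real.log (n.factorial : ℕ)) / n := by
      rw [le_div_iff₀ hnR]; linarith only [h2]
    linarith only [h3]
  have hmfac : Real.log m ≤ Real.log (c.factorial : ℕ) :=
    Real.log_le_log (by exact_mod_cast hm1) (by exact_mod_cast hMfac p hp)
  have hL0 : (Real.log m - Real.log (c.factorial : ℕ)) / c ≤ 0 :=
    div_nonpos_of_nonpos_of_nonneg (by linarith only [hmfac]) hcR.le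
  have hcomp : -Real.log K + μ * Real.log n ≤ (Real.log m - Real.log (c.factorial : ℕ)) / c + μ * Real.log c := by
    rw [← hφp]; exact le_trans hφ0 (hmax _ h0)
  have hlogcn : Real.log c ≤ Real.log n := Real.log_le_log hcR (by exact_mod_cast hcn)
  -- richness of the piece
  have hrich : -Real.log K ≤ (Real.log m - Real.log (c.factorial : ℕ)) / c := by
    nlinarith only [hcomp, hlogcn, hμ0]
  -- size of the piece: n ≤ K^{32K} · c
  have hsize : n ≤ K ^ (32 * K) * c := by
    have h1 : μ * Real.log n ≤ μ * Real.log c + Real.log K := by linarith only [hcomp, hL0]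
    have h2 : Real.log n ≤ Real.log c + 32 * K * Real.log K := by
      have hμK : μ * (32 * K) = 1 := by rw [hμ]; field_simp
      calc Real.log n = μ * Real.log n * (32 * K) := by rw [mul_comm μ, mul_assoc, hμK, mul_one]
        _ ≤ (μ * Real.log c + Real.log K) * (32 * K) := mul_le_mul_of_nonneg_right h1 (by positivity)
        _ = Real.log c * (μ * (32 * K)) + 32 * K * Real.log K := by ring
        _ = Real.log c + 32 * K * Real.log K := by rw [hμK, mul_one]
    have h5 : (n : ℝ) ≤ (K : ℝ) ^ (32 * K) * c := by
      have h6 : Real.log n ≤ Real.log ((K : ℝ) ^ (32 * K) * c) := by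
        rw [Real.log_mul (by positivity) hcR.ne', Real.log_pow]; push_cast; linarith only [h2]
      exact (Real.log_le_log_iff (by exact_mod_cast hn1) (by positivity)).mp h6
    exact_mod_cast h5
  have hc2 : 2 ≤ c := by
    by_contra h
    have : c = 1 := by omega
    rw [this, mul_one] at hsize
    omega
  -- Step C: minimum row degree
  have hrowdeg : ∀ x ∈ p.1, c ≤ 4 * K * (p.2.filter fun j => (x, j) ∈ G).card := by
    intro x hx
    by_contra hlt
    push Not at hlt
    obtain ⟨y, hy, hadm', hMle⟩ := hrow p hp x hx hc2
    set d := (p.2.filter fun j => (x, j) ∈ G).card with hd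
    set m' := M (p.1.erase x) (p.2.erase y) with hm'
    have hm'1 : 1 ≤ m' := hM1 _ hadm'
    have hd1 : 1 ≤ d := by
      rcases Nat.eq_zero_or_pos d with h0' | h0'
      · rw [h0', zero_mul] at hMle; omega
      · exact h0'
    have key := phi_lt_of_removal K c d m m' hK hc2 hm1 hm'1 hd1 hMle hlt hrich
    have hφ' : φ (p.1.erase x, p.2.erase y) =
        (Real.log m' - Real.log ((c - 1).factorial : ℕ)) / ((c - 1 : ℕ) : ℝ) + μ * Real.log ((c - 1 : ℕ) : ℝ) := by
      show (Real.log (M (p.1.erase x) (p.2.erase y)) - Real.log ((p.2.erase y).card.factorial : ℕ)) /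
          (p.2.erase y).card + μ * Real.log ((p.2.erase y).card : ℕ) = _
      rw [Finset.card_erase_of_mem hy]
    have := hmax _ hadm'
    rw [hφ', hφp] at this
    linarith only [this, key]
  -- Step C': minimum column degree
  have hcoldeg : ∀ y ∈ p.2, c ≤ 4 * K * (p.1.filter fun i => (i, y) ∈ G).card := by
    intro y hy
    by_contra hlt
    push Not at hlt
    obtain ⟨x, hx, hadm', hMle⟩ := hcol p hp y hy hc2
    set d := (p.1.filter fun i => (i, y) ∈ G).card with hd
    set m' := M (p.1.erase x) (p.2.erase y) with hm'
    have hm'1 : 1 ≤ m' := hM1 _ hadm'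
    have hd1 : 1 ≤ d := by
      rcases Nat.eq_zero_or_pos d with h0' | h0'
      · rw [h0', zero_mul] at hMle; omega
      · exact h0'
    have key := phi_lt_of_removal K c d m m' hK hc2 hm1 hm'1 hd1 hMle hlt hrich
    have hφ' : φ (p.1.erase x, p.2.erase y) =
        (Real.log m' - Real.log ((c - 1).factorial : ℕ)) / ((c - 1 : ℕ) : ℝ) + μ * Real.log ((c - 1 : ℕ) : ℝ) := by
      show (Real.log (M (p.1.erase x) (p.2.erase y)) - Real.log ((p.2.erase y).card.factorial : ℕ)) /
          (p.2.erase y).card + μ * Real.log ((p.2.erase y).card : ℕ) = _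
      rw [Finset.card_erase_of_mem hy]
    have := hmax _ hadm'
    rw [hφ', hφp] at this
    linarith only [this, key]
  -- Step D: surplus
  refine ⟨p, hp, hsize, hc2, hrowdeg, hcoldeg, ?_⟩
  intro U hU hUne hUs
  by_contra hlt
  push Not at hlt
  set s := c / (2048 * K ^ 2) + 1 with hs
  set ν := (p.2.filter fun j => ∃ r ∈ U, (r, j) ∈ G).card with hν
  have hRC : p.1.card = c := hcard p hp
  have hs1 : 1 ≤ s := Nat.le_add_left 1 _
  have hUlt : U.card < p.1.card := by rw [hRC]; omega
  obtain ⟨S, hS, hScard, hadm₁, hadm₂, hMle⟩ := hsplit p hp U hU hUne hUlt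
  set u := U.card with hu
  have hu1 : 1 ≤ u := by rw [hu]; exact Finset.card_pos.mpr hUne
  set m₁ := M U S with hm₁
  set m₂ := M (p.1 \ U) (p.2 \ S) with hm₂
  have hm₁1 : 1 ≤ m₁ := hM1 _ hadm₁
  have hm₂1 : 1 ≤ m₂ := hM1 _ hadm₂
  -- ν ≥ degree of a row of U
  have hνdeg : c ≤ 4 * K * ν := by
    obtain ⟨x, hxU⟩ := hUne
    have hx : x ∈ p.1 := hU hxU
    have hsub : (p.2.filter fun j => (x, j) ∈ G) ⊆ (p.2.filter fun j => ∃ r ∈ U, (r, j) ∈ G) := by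
      intro j hj
      simp only [Finset.mem_filter] at hj ⊢
      exact ⟨hj.1, x, hxU, hj.2⟩
    calc c ≤ 4 * K * (p.2.filter fun j => (x, j) ∈ G).card := hrowdeg x hx
      _ ≤ 4 * K * ν := Nat.mul_le_mul_left _ (Finset.card_le_card hsub)
  -- a column outside N(U) has all its neighbours in R \ U
  have hcu : c ≤ 4 * K * (c - u) := by
    have hνlt : ν < c := by omega
    have hex : ((p.2 \ (p.2.filter fun j => ∃ r ∈ U, (r, j) ∈ G))).Nonempty := by
      rw [← Finset.card_pos, Finset.card_sdiff_of_subset (Finset.filter_subset _ _)]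
      omega
    obtain ⟨y, hy⟩ := hex
    rw [Finset.mem_sdiff] at hy
    have hyC : y ∈ p.2 := hy.1
    have hsub : (p.1.filter fun i => (i, y) ∈ G) ⊆ p.1 \ U := by
      intro i hi
      simp only [Finset.mem_filter] at hi
      rw [Finset.mem_sdiff]
      refine ⟨hi.1, fun hiU => hy.2 ?_⟩
      simp only [Finset.mem_filter]
      exact ⟨hyC, i, hiU, hi.2⟩
    calc c ≤ 4 * K * (p.1.filter fun i => (i, y) ∈ G).card := hcoldeg y hyC
      _ ≤ 4 * K * (p.1 \ U).card := Nat.mul_le_mul_left _ (Finset.card_le_card hsub)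
      _ = 4 * K * (c - u) := by rw [Finset.card_sdiff_of_subset hU, hRC]
  -- the potentials of the two parts
  have hφ₁ : φ (U, S) = (Real.log m₁ - Real.log (u.factorial : ℕ)) / u + μ * Real.log u := by
    show (Real.log (M U S) - Real.log (S.card.factorial : ℕ)) / S.card + μ * Real.log (S.card : ℕ) = _
    rw [hScard]
  have hφ₂ : φ (p.1 \ U, p.2 \ S) =
      (Real.log m₂ - Real.log ((c - u).factorial : ℕ)) / ((c - u : ℕ) : ℝ) + μ * Real.log ((c - u : ℕ) : ℝ) := by
    show (Real.log (M (p.1 \ U) (p.2 \ S)) - Real.log ((p.2 \ S).card.factorial : ℕ)) / (p.2 \ S).card +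
        μ * Real.log ((p.2 \ S).card : ℕ) = _
    rw [Finset.card_sdiff_of_subset hS, hScard]
  have hmax₁ := hmax _ hadm₁
  have hmax₂ := hmax _ hadm₂
  rw [hφ₁, hφp] at hmax₁
  rw [hφ₂, hφp] at hmax₂
  exact split_absurd K c u ν s m m₁ m₂ hK hu1 hs hUs (by omega) hνdeg hcu hm1 hm₁1 hm₂1 hMle hmax₁ hmax₂

end Summit.ValiantsHypothesis.ValiantsHypothesis.Theorems.DivisionGap.PerMultiplesHard.RichPiece
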